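import Literature.MathematicalPhysics.QuantumFieldTheory.Balaban1983to89.B9Eq3126H1kLipschitzEnergyLetterfree
import Literature.MathematicalPhysics.QuantumFieldTheory.Balaban1983to89.B7Eq43AveragedSmallnessLinearFeed

/-!
# `Balaban1983to89.B9Eq3126H1kLipschitzEnergyTwoWindows` — T. Bałaban, *Propagators for lattice gauge theories in a background field*, Commun. Math. Phys.
# **99** (1985) 389–434 [Balaban1985BackgroundPropagators] (3.126) p. 420 *«HB = GQ*(QGQ*)⁻¹B»* with Thm 3.4 p. 400, (3.84)–(3.86) p. 407, Thm 3.11 p. 416 and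
# (3.35)–(3.37) p. 396 AT `k = n+1` AVERAGING LEVELS ON PRINT's DIAGONAL `ηL^{n+1} = 1`: **`H_{1,k}(U) − H_{1,k}(1) = O(α)` IN THE FLAT ENERGY NORM ON PRINT's
# CLASS (3.35) — NO OPERATOR LETTER, NO PROFILE BINDER** — ne9-leaf-02's `B9Eq3126H1kLipschitzEnergyLetterfree.exists_norm_H1k_sub_flat_le_letterfree` (the
# row OWNER's INTENT-6 with `C_R`, `C_{K,1}`, `C_{K,U}` closed) with the level-profile binders `εU ∕ hεU ∕ hUε ∕ hεg ∕ r ∕ hUb` STRUCK by this lineage's α-LINEAR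
# feed (`B7Eq43AveragedSmallnessLinearFeed`): the background valued in an averaging-closed `S ≤ U1`, unitary, bonds `αη`-close, plaquettes `αη²`-close

statement-level skeleton of published theorems with citation tags; proofs where landed; nothing here is a claim about the Yang–Mills mass gap

CITATION HEADER (lean-in-tree rule).  Audit cell `pub-balaban`, sub-cell `t4`, BINDER row NE9; filed by NE9 formalisation-swarm leaf prover 03
(`b2b-balaban-t4-ne9-formalise-leaf-03`, gen 66), INTENT I-ne9leaf03-g66-E (first refusal ne9-leaf-02, author of the letter-free file; the OWNER t4-ne9-p1 g86 W-8:
«NOT MINE, GO, THIS SHAPE»).  Sources READ in the held text `paper:balaban1985-cmp99-background-propagators` pp. 396, 400, 407, 416, 420.  Objects BY NAME: the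
owner's `laplaceAk`, `QkW`, `RofUk`, `hessOp`; `H1LatticeK`, `covCurlL2K`, `covDivL2K`; nothing re-declared, 0 `def`.

THE PRINT (verbatim).  p. 420 (3.126): *«HB = GQ*(QGQ*)⁻¹B»*; p. 400, Thm 3.4: *«… describing these analytic extensions as small perturbations of the operators
depending on U only»*; p. 396 (3.35): bonds `αη`, plaquettes `αη²` — the averaged configurations' smallness (3.37) is a consequence.

WHAT IS PROVED (sorry-free; proof lane — 0 `def`; [folklore] binder plumbing over landed files).
* **`exists_norm_H1k_sub_flat_le_twoWindows`** — `∃ α₀ C > 0` (closed in `(d, a, L, M_φ, M_φ′, C_τ, ρ_w)`; `C = K·C^{letterfree}(r = 1∕L)`, `K = 1 + 512(d+1)(d+4)`)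
  BEFORE `∀ n (3 ≤ L^{n+1}) η (ηL^{n+1} = 1) c₀ c₁ (c₀(L^{n+1})^d = c₁) (|η|^d∕c₀ ≤ ρ_w) m U (E162's data) S (AvgClosed) (U(b) ∈ S) α (0 ≤ α ≤ α₀) (U(b)* = U(b)⁻¹)
  (‖U(b) − 1‖ ≤ αη) (‖U(∂p) − 1‖ ≤ αη²)`, ANY `hposU hpos1 hQU hQ1`, every block field `b`: `‖H_k(U)b − H_k(1)b‖ ≤ Cα‖b‖ ∧ ‖curl₁(…)‖ ≤ Cα‖b‖ ∧ ‖div₁(…)‖ ≤ Cα‖b‖`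
  (the flat letters written out as in the host).
HONEST SCOPE.  [folklore]; FIRST order at the flat point on the diagonal ONLY; the two WINDOWS, unitarity, E162's data, the trace letters, `ρ_w`, `1 ≤ d`,
`3 ≤ L^{n+1}` and the four witnesses stay HYPOTHESES; the fine-bond window is NOT derived from plaquettes (torus holonomies; per cube = the IMS road); no kernel
bound, no decay, NOT the (N)-reading; «NE9 ⇐ the named binders»; NE9 NOT PRINTED ∕ NOT PROVED; NOT summit progress (cell pub-balaban: row NE9 WALLED ON A MODEL
(O-NE9-1; #5 UNRULED); spine PROVED 0/9; rung (B)+1 finite T⁴ — NOT infinite volume, NOT mass gap, NOT BetaPertH, NOT Clay; HONEST DEPENDENCY: continuum YM on T⁴ ⇐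
BetaPertH ∧ nine spine estimates (0/9 proved); BetaPertH ⇐ (D1) ∧ (D4) ∧ CAP+tail; G-an2-4 gates asym, D1 and NE2/3/4).  NEW file; nothing modified.  Net new unproved facts: 0.
-/

noncomputable section

open scoped InnerProductSpace ComplexConjugate BigOperators

namespace Literature.MathematicalPhysics.QuantumFieldTheory.Balaban1983to89.B9Eq3126H1kLipschitzEnergyTwoWindows

open B4Sect5Torus (TSite)
open B9SectCLatticeCarrier (Bond)
open B11Eq103H1Complex (BondL2K covDivL2K H1LatticeK)
open B9Eq310HessianOperator (adTransportW hessOp covCurlL2K)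
open B9Eq310DeltaPrime (plaqHolU)
open B9Eq315QTorus (perCfg cornerSite)
open B9Eq315QTower (towerP UlevOf)
open B9Eq315QTowerFlat (perCfg_UlevOf_one_mem_U1 norm_Wcx_UlevOf_one_sub_one_le)
open B9Eq326OperatorTower (laplaceAk QkW RofUk)
open B7Prop1Explicit (U1 Wcx boxVec)
open B7Prop2Explicit (AvgClosed)
open B9Eq3126H1kLipschitzEnergyLetterfree (exists_norm_H1k_sub_flat_le_letterfree)
open B7Eq43AveragedSmallnessLinearFeed (twoWindows_linear_feed)

variable {d : ℕ} (hd : 1 ≤ d) (L : ℕ) [NeZero L] (hL : 1 ≤ L) (hL2 : 2 ≤ L)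
  {𝔸 : Type*} [NormedRing 𝔸] [NormedAlgebra ℂ 𝔸] [CompleteSpace 𝔸] [NormOneClass 𝔸] [StarRing 𝔸] [NormedStarGroup 𝔸] [StarModule ℂ 𝔸]
  {W : Type*} [NormedAddCommGroup W] [InnerProductSpace ℂ W] [FiniteDimensional ℂ W] (φ : W ≃ₗ[ℂ] 𝔸)
  {Mφ Mφ' : ℝ} (hMφ : 0 ≤ Mφ) (hMφ' : 0 ≤ Mφ') (hφ : ∀ w, ‖φ w‖ ≤ Mφ * ‖w‖) (hφ' : ∀ X, ‖φ.symm X‖ ≤ Mφ' * ‖X‖)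
  {a : ℝ} (ha : 0 < a) (τ : 𝔸 →ₗ[ℂ] ℂ) {Cτ : ℝ} (hτ : ∀ X, ‖τ X‖ ≤ Cτ * ‖X‖) (hCτ : 0 ≤ Cτ) {ρw : ℝ} (hρw : 0 ≤ ρw)
  (hτ₁ : ∀ X : 𝔸, τ (star X) = conj (τ X)) (hτ₂ : ∀ X Y : 𝔸, τ (X * Y) = τ (Y * X))
  (hφτ : ∀ X Y : 𝔸, ⟪φ.symm X, φ.symm Y⟫_ℂ = τ (star X * Y))

include hd hL2 hMφ hMφ' hφ hφ' ha hτ hCτ hρw hτ₁ hτ₂ hφτ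

/-- **`H_{1,k}(U) − H_{1,k}(1) = O(α)` IN THE FLAT ENERGY NORM ON PRINT's CLASS (3.35) — NO OPERATOR LETTER, NO PROFILE BINDER**: there are `α₀, C > 0` (closed in
`(d, a, L, M_φ, M_φ′, C_τ, ρ_w)`) such that for every `n` with `3 ≤ L^{n+1}`, `η` (`ηL^{n+1} = 1`), `c₀, c₁` (`c₀(L^{n+1})^d = c₁`, `|η|^d∕c₀ ≤ ρ_w`), `m`, background
`U` of E162's data valued in an averaging-closed `S`, `0 ≤ α ≤ α₀`, unitary (`U(b)* = U(b)⁻¹`), in the two windows `‖U(b) − 1‖ ≤ αη`, `‖U(∂p) − 1‖ ≤ αη²`, ANY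
positivity witnesses `hposU`, `hpos1`, ANY onto-witnesses `hQU`, `hQ1`, and every block field `b`: `‖H_k(U)b − H_k(1)b‖ ≤ Cα‖b‖`, `‖curl₁(H_k(U)b − H_k(1)b)‖ ≤ Cα‖b‖`,
`‖div₁(H_k(U)b − H_k(1)b)‖ ≤ Cα‖b‖` — ne9-leaf-02's `exists_norm_H1k_sub_flat_le_letterfree` at `r = 1∕L`, fed at `β = Kα` by `twoWindows_linear_feed`.
[cite: Balaban1985BackgroundPropagators, (3.126) p.420, Thm 3.4 p.400, (3.25) p.394, p.403, (3.84)–(3.86) p.407, Thm 3.11 p.416, (3.35)–(3.37) p.396; Balaban1985Variational, (45)–(46) p.285; Balaban1985Averaging, Prop. 2 (52)–(54) p.26] -/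
theorem exists_norm_H1k_sub_flat_le_twoWindows :
    ∃ α₀ C : ℝ, 0 < α₀ ∧ 0 < C ∧ ∀ (n : ℕ) (η : ℝ), η * (L : ℝ) ^ (n + 1) = 1 → 3 ≤ L ^ (n + 1) →
      ∀ (c₀ c₁ : ℝ) [Fact (0 < c₀)] [Fact (0 < c₁)], c₀ * ((L : ℝ) ^ (n + 1)) ^ d = c₁ → |η| ^ d / c₀ ≤ ρw →
      ∀ (m : Fin d → ℕ) [∀ i, NeZero (m i)] (U : Bond d (towerP L m (n + 1)) → 𝔸ˣ) (αU : ℕ → ℝ) (hα1 : ∀ j, αU j ≤ 1 / 64)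
        (hU1 : ∀ (j : ℕ) (x : B7Prop1Explicit.Site d) (κ : Fin d), perCfg (towerP L m (j + 1)) (UlevOf L m (n + 1) U j) x κ ∈ U1 𝔸)
        (hreg : ∀ (j : ℕ) (y : TSite d (towerP L m j)) (κ : Fin d) (r : Fin d → Fin L),
          ‖((Wcx L (perCfg (towerP L m (j + 1)) (UlevOf L m (n + 1) U j)) (cornerSite L y) κ (boxVec L r) : 𝔸ˣ) : 𝔸) - 1‖ ≤ αU j)
        {S : Subgroup 𝔸ˣ}, AvgClosed d L S → (∀ b, U b ∈ S) →
      ∀ {α : ℝ}, 0 ≤ α → α ≤ α₀ →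
        (∀ b, star (U b : 𝔸) = (((U b)⁻¹ : 𝔸ˣ) : 𝔸)) →
        (∀ b, ‖(U b : 𝔸) - 1‖ ≤ α * η) →
        (∀ p : B9SectCLatticeCarrier.Plaq d (towerP L m (n + 1)), ‖(plaqHolU U p : 𝔸) - 1‖ ≤ α * η ^ 2) →
        ∀ (hposU : ∀ x : BondL2K ℂ d (towerP L m (n + 1)) c₀ W, x ≠ 0 →
            0 < RCLike.re ⟪x, laplaceAk L m n φ η U hL αU hα1 hU1 hreg τ (c₀ := c₀) (c₁ := c₁) a x⟫_ℂ)
          (hpos1 : ∀ x : BondL2K ℂ d (towerP L m (n + 1)) c₀ W, x ≠ 0 →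
            0 < RCLike.re ⟪x, laplaceAk L m n φ η (fun _ : Bond d (towerP L m (n + 1)) => (1 : 𝔸ˣ)) hL (fun _ => 0) (fun _ => by norm_num)
              (perCfg_UlevOf_one_mem_U1 L m (n + 1)) (norm_Wcx_UlevOf_one_sub_one_le L m (n + 1) (fun _ => 0) (fun _ => le_rfl)) τ
              (c₀ := c₀) (c₁ := c₁) a x⟫_ℂ)
          (hQU : Function.Surjective (QkW L m n φ U hL αU hα1 hU1 hreg (c₀ := c₀) (c₁ := c₁)))
          (hQ1 : Function.Surjective (QkW L m n φ (fun _ : Bond d (towerP L m (n + 1)) => (1 : 𝔸ˣ)) hL (fun _ => 0) (fun _ => by norm_num)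
            (perCfg_UlevOf_one_mem_U1 L m (n + 1)) (norm_Wcx_UlevOf_one_sub_one_le L m (n + 1) (fun _ => 0) (fun _ => le_rfl)) (c₀ := c₀) (c₁ := c₁))),
        ∀ b : BondL2K ℂ d m c₁ W,
          ‖H1LatticeK hposU hQU b - H1LatticeK (c := ((η : ℂ))⁻¹) (R := adTransportW φ (fun _ : Bond d (towerP L m (n + 1)) => (1 : 𝔸ˣ)))
              (S := adTransportW φ fun _ : Bond d (towerP L m (n + 1)) => (1 : 𝔸ˣ)⁻¹) (Δ₁ := hessOp φ η (fun _ : Bond d (towerP L m (n + 1)) => (1 : 𝔸ˣ)) τ)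
              (Rr := RofUk L m n φ η (fun _ : Bond d (towerP L m (n + 1)) => (1 : 𝔸ˣ)))
              (Q := (QkW L m n φ (fun _ : Bond d (towerP L m (n + 1)) => (1 : 𝔸ˣ)) hL (fun _ => 0) (fun _ => by norm_num)
            (perCfg_UlevOf_one_mem_U1 L m (n + 1)) (norm_Wcx_UlevOf_one_sub_one_le L m (n + 1) (fun _ => 0) (fun _ => le_rfl)) (c₀ := c₀) (c₁ := c₁))) (a := a) hpos1 hQ1 b‖ ≤ C * α * ‖b‖ ∧
          ‖covCurlL2K ℂ c₀ ((η : ℂ))⁻¹ (adTransportW φ (fun _ : Bond d (towerP L m (n + 1)) => (1 : 𝔸ˣ)))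
            (H1LatticeK hposU hQU b - H1LatticeK (c := ((η : ℂ))⁻¹) (R := adTransportW φ (fun _ : Bond d (towerP L m (n + 1)) => (1 : 𝔸ˣ)))
              (S := adTransportW φ fun _ : Bond d (towerP L m (n + 1)) => (1 : 𝔸ˣ)⁻¹) (Δ₁ := hessOp φ η (fun _ : Bond d (towerP L m (n + 1)) => (1 : 𝔸ˣ)) τ)
              (Rr := RofUk L m n φ η (fun _ : Bond d (towerP L m (n + 1)) => (1 : 𝔸ˣ)))
              (Q := (QkW L m n φ (fun _ : Bond d (towerP L m (n + 1)) => (1 : 𝔸ˣ)) hL (fun _ => 0) (fun _ => by norm_num)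
            (perCfg_UlevOf_one_mem_U1 L m (n + 1)) (norm_Wcx_UlevOf_one_sub_one_le L m (n + 1) (fun _ => 0) (fun _ => le_rfl)) (c₀ := c₀) (c₁ := c₁))) (a := a) hpos1 hQ1 b)‖ ≤ C * α * ‖b‖ ∧
          ‖covDivL2K ℂ c₀ ((η : ℂ))⁻¹ (adTransportW φ fun _ : Bond d (towerP L m (n + 1)) => (1 : 𝔸ˣ)⁻¹)
            (H1LatticeK hposU hQU b - H1LatticeK (c := ((η : ℂ))⁻¹) (R := adTransportW φ (fun _ : Bond d (towerP L m (n + 1)) => (1 : 𝔸ˣ)))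
              (S := adTransportW φ fun _ : Bond d (towerP L m (n + 1)) => (1 : 𝔸ˣ)⁻¹) (Δ₁ := hessOp φ η (fun _ : Bond d (towerP L m (n + 1)) => (1 : 𝔸ˣ)) τ)
              (Rr := RofUk L m n φ η (fun _ : Bond d (towerP L m (n + 1)) => (1 : 𝔸ˣ)))
              (Q := (QkW L m n φ (fun _ : Bond d (towerP L m (n + 1)) => (1 : 𝔸ˣ)) hL (fun _ => 0) (fun _ => by norm_num)
            (perCfg_UlevOf_one_mem_U1 L m (n + 1)) (norm_Wcx_UlevOf_one_sub_one_le L m (n + 1) (fun _ => 0) (fun _ => le_rfl)) (c₀ := c₀) (c₁ := c₁))) (a := a) hpos1 hQ1 b)‖ ≤ C * α * ‖b‖ := by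
  have hL0 : (0 : ℝ) < L := by exact_mod_cast lt_of_lt_of_le (by norm_num) hL2
  have hr0 : (0 : ℝ) ≤ 1 / (L : ℝ) := by positivity
  have hr1 : 1 / (L : ℝ) < 1 := by rw [div_lt_one hL0]; exact_mod_cast lt_of_lt_of_le (by norm_num) hL2
  -- ne9-leaf-02's letter-free `∃` at `r = 1∕L`
  obtain ⟨α₁, C, hα₁, hC, H⟩ :=
    exists_norm_H1k_sub_flat_le_letterfree hd L hL φ hMφ hMφ' hφ hφ' ha hr0 hr1 τ hτ hCτ hρw hτ₁ hτ₂ hφτ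
  -- the α-linear feed below its threshold
  obtain ⟨T, hT, F⟩ := twoWindows_linear_feed L hL2 (d := d) (𝔸 := 𝔸) hα₁
  refine ⟨T, C * (1 + 512 * (d + 1) * (d + 4)), hT, by positivity, ?_⟩
  intro n η hηL hL3 c₀ c₁ _ _ hw hρ m _ U αU hα1 hU1 hreg S hS hU α hα0 hαle hUst hUη hpl hposU hpos1 hQU hQ1 b
  obtain ⟨hβ0, hβ1, hUb, hUη', hpl', -, εU, hεU, hUε, hεg⟩ := F m n hS hU hηL hα0 hαle hUη hpl
  obtain ⟨h1, h2, h3⟩ :=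
    H n η hηL hL3 c₀ c₁ hw hρ m U αU hα1 hU1 hreg εU hεU hUε hβ0 hβ1 hUst hUb hUη' hpl' hεg hposU hpos1 hQU hQ1 b
  exact ⟨h1.trans_eq (by ring), h2.trans_eq (by ring), h3.trans_eq (by ring)⟩

end Literature.MathematicalPhysics.QuantumFieldTheory.Balaban1983to89.B9Eq3126H1kLipschitzEnergyTwoWindows

end
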